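import Literature.Analysis.FluidPDE.LeiZhang2011MoserStep
import Literature.Analysis.FluidPDE.LeiZhang2011Cutoff
import Literature.Analysis.FluidPDE.SpaceTimeAxisIntegrable
import Mathlib.MeasureTheory.Function.SpecialFunctions.Inner
import HarnessLib

/-!
# Lei–Zhang 2011, §2: one Moser step between two cylinders, all side conditions discharged

Analysis/FluidPDE proofs file (theorems only), on the discharge path of the named fact
`Literature.Analysis.FluidPDE.LeiZhang2011_liouville` (Z. Lei, Q. S. Zhang, J. Funct. Anal. 261
(2011) = arXiv:1011.5066, §2 (2.4)–(2.5)). `LeiZhang2011.reverse_holder_step` is the analytic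
core of one Moser step with the cut-offs, the integrability of the slice functionals and the
John–Nirenberg bound of the stream oscillation as hypotheses. Here these are discharged from a
uniform set of hypotheses on the cylinder `Q(ρ) = (−ρ², 0] × B̄(0, ρ)` — the "setting at
radius `ρ`": the smooth axisymmetric solution `F` of the time-integrated swirl-type equation with
drift `b = curl B` a.e., `‖B(s)‖_BMO ≤ C_B` for a.e. `s`, joint continuity of `F` and `∇F`,
integrability of `N` on the cylinder, a jointly measurable drift bounded on the cylinder — for
any radii `0 < r₂ < r₁ ≤ ρ`, with the cut-offs of `LeiZhang2011Cutoff`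
(`LeiZhang2011.reverse_holder_between_cylinders`). The absolute constants of the cut-offs and
of the John–Nirenberg bound enter as parameters with their defining properties.

## References

* Z. Lei, Q. S. Zhang, J. Funct. Anal. 261 (2011) = arXiv:1011.5066, §2 (2.1)–(2.5), pp. 5–8.
  [LeiZhang2011]
-/

noncomputable section

open MeasureTheory Set Function Filter Metric intervalIntegral
open _root_.Topology
open scoped InnerProductSpace RealInnerProductSpace NNReal ENNReal Laplacian

namespace Literature.Analysis.FluidPDE

namespace LeiZhang2011

open Literature.Analysis.FunctionSpaces

/-- A parametric integral of a jointly continuous integrand supported in a fixed compact set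
(in the space variable) is continuous in the parameter. [folklore] -/
theorem continuous_integral_of_continuous_of_support {f : ℝ → EuclideanSpace ℝ (Fin 3) → ℝ}
    (hf : Continuous fun p : ℝ × EuclideanSpace ℝ (Fin 3) => f p.1 p.2)
    {K : Set (EuclideanSpace ℝ (Fin 3))} (hK : IsCompact K) (hfK : ∀ s x, x ∉ K → f s x = 0) :
    Continuous fun s => ∫ x, f s x := by
  have h := continuous_parametric_integral_of_continuous
    (μ := (volume : Measure (EuclideanSpace ℝ (Fin 3)))) (f := f) hf hK
  refine h.congr fun s => ?_
  exact setIntegral_eq_integral_of_forall_compl_eq_zero fun x hx => hfK s x hx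

/-- The time-integrated equation restricts to a later base point: if
`F(s) = F(a) + ∫_a^s N` on `[a, c]`, then `F(s) = F(a') + ∫_{a'}^s N` on `[a', c]` for
`a ≤ a'`. [folklore] -/
theorem integrated_eq_rebase {Nx Fx : ℝ → ℝ} {a a' c : ℝ} (haa' : a ≤ a') (ha'c : a' ≤ c)
    (hN : IntervalIntegrable Nx volume a c)
    (hF : ∀ s ∈ Icc a c, Fx s = Fx a + ∫ τ in a..s, Nx τ) :
    IntervalIntegrable Nx volume a' c ∧ ∀ s ∈ Icc a' c, Fx s = Fx a' + ∫ τ in a'..s, Nx τ := by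
  have hac : a ≤ c := haa'.trans ha'c
  have hsub : ∀ {u v : ℝ}, a ≤ u → u ≤ v → v ≤ c → IntervalIntegrable Nx volume u v := by
    intro u v hu huv hv
    refine hN.mono_set ?_
    rw [uIcc_of_le huv, uIcc_of_le hac]
    exact Icc_subset_Icc hu hv
  refine ⟨hsub haa' ha'c le_rfl, fun s hs => ?_⟩
  have h1 := hF s ⟨haa'.trans hs.1, hs.2⟩
  have h2 := hF a' ⟨haa', ha'c⟩
  have hadd := intervalIntegral.integral_add_adjacent_intervals (hsub le_rfl haa' ha'c)
    (hsub haa' hs.1 hs.2)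
  linarith

/-- **One Moser step between two cylinders, side conditions discharged** (Lei–Zhang 2011,
(2.1)–(2.5)). In the setting at radius `ρ` described in the module docstring, for a convex
`H ∈ C²` with `H(0) = 0`, `H'² ≤ κHH''`, `κ ≥ 1` and a `C¹` square root `s_H`, and radii
`0 < r₂ < r₁ ≤ ρ`,
`∬_{(−r₂²,0)×B(0,r₂)} H(F)^{5/3} ≤ K · (∬_{(−r₁²,0]×B̄(0,r₁)} H(F)^{3/2})^{10/9}`
with the constant `K` of `reverse_holder_step` for `D = C_φ/(r₁ − r₂)`, `D' = C_T/(r₁² − r₂²)`,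
`T₁ = r₁²`. [cite: LeiZhang2011, §2 (2.1)–(2.5) (arXiv pp. 5–8)] -/
theorem reverse_holder_between_cylinders
    {ρ : ℝ} {CB : ℝ≥0}
    {F N : ℝ → EuclideanSpace ℝ (Fin 3) → ℝ}
    {b Bst : ℝ → EuclideanSpace ℝ (Fin 3) → EuclideanSpace ℝ (Fin 3)}
    (hF2 : ∀ s, ContDiff ℝ 2 (F s)) (hFa : ∀ s, IsAxisymmetricScalar (F s))
    (hF0 : ∀ s x, cylRadius x = 0 → F s x = 0)
    (hb : ∀ s, LocallyIntegrable (b s) volume)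
    (hBst : ∀ᵐ s ∂(volume.restrict (Ioc (-ρ ^ 2) 0)),
      Differentiable ℝ (Bst s) ∧ curl (Bst s) =ᵐ[volume] b s ∧ eBMOSeminormVec (Bst s) ≤ CB)
    (hN : ∀ s x, N s x =
      (Δ (F s)) x - fderiv ℝ (F s) x (b s x) - 2 / cylRadius x * fderiv ℝ (F s) x (eR x))
    (heq : ∀ᵐ x ∂(volume : Measure (EuclideanSpace ℝ (Fin 3))),
      IntervalIntegrable (fun s => N s x) volume (-ρ ^ 2) 0 ∧
        ∀ s ∈ Icc (-ρ ^ 2) 0, F s x = F (-ρ ^ 2) x + ∫ τ in (-ρ ^ 2)..s, N τ x)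
    (hFc : Continuous fun p : ℝ × EuclideanSpace ℝ (Fin 3) => F p.1 p.2)
    (hF1c : Continuous fun p : ℝ × EuclideanSpace ℝ (Fin 3) => gradient (F p.1) p.2)
    (hNm : AEStronglyMeasurable (fun p : ℝ × EuclideanSpace ℝ (Fin 3) => N p.1 p.2)
      ((volume.restrict (Ioc (-ρ ^ 2) 0)).prod volume))
    (hNi : Integrable (fun p : ℝ × EuclideanSpace ℝ (Fin 3) => N p.1 p.2)
      ((volume.restrict (Ioc (-ρ ^ 2) 0)).prod (volume.restrict (closedBall 0 ρ))))
    (hbm : AEStronglyMeasurable (fun p : ℝ × EuclideanSpace ℝ (Fin 3) => b p.1 p.2)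
      ((volume.restrict (Ioc (-ρ ^ 2) 0)).prod volume))
    {Mb : ℝ} (hbB : ∀ s, ∀ x ∈ closedBall (0 : EuclideanSpace ℝ (Fin 3)) ρ, ‖b s x‖ ≤ Mb)
    -- the nonlinearity
    {H sH : ℝ → ℝ} (hH : ContDiff ℝ 2 H) (hH00 : H 0 = 0) (hH0 : ∀ v, 0 ≤ H v)
    (hH2 : ∀ v, 0 ≤ deriv (deriv H) v) {κ : ℝ} (hκ1 : 1 ≤ κ)
    (hκ : ∀ v, deriv H v ^ 2 ≤ κ * H v * deriv (deriv H) v)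
    (hsH : ContDiff ℝ 1 sH) (hsH2 : ∀ v, sH v ^ 2 = H v)
    (hsH' : ∀ v, 2 * deriv sH v ^ 2 ≤ deriv (deriv H) v)
    -- the absolute constants
    {Cφ : ℝ} (hCφ : ∀ ρ₂ ρ₁ : ℝ, 0 ≤ ρ₂ → ρ₂ < ρ₁ → ∀ z : EuclideanSpace ℝ (Fin 3),
      ‖gradient (radialCutoff ρ₂ ρ₁ : EuclideanSpace ℝ (Fin 3) → ℝ) z‖ ≤ Cφ / (ρ₁ - ρ₂))
    {CT : ℝ} (hCT : ∀ t, |deriv Real.smoothTransition t| ≤ CT)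
    {CJ : ℝ} (hCJ0 : 0 ≤ CJ)
    (hCJ : ∀ (B : EuclideanSpace ℝ (Fin 3) → EuclideanSpace ℝ (Fin 3)), Continuous B →
      ∀ (C : ℝ≥0), eBMOSeminormVec B ≤ C → ∀ (r : ℝ), 0 < r →
        ∃ c : EuclideanSpace ℝ (Fin 3),
          (∫ x in closedBall (0 : EuclideanSpace ℝ (Fin 3)) r, (‖B x - c‖ ^ 2) ^ (3 : ℝ)) ^ (1 / (3 : ℝ)) ≤
            CJ * (C : ℝ) ^ 2 * (volume.real (ball (0 : EuclideanSpace ℝ (Fin 3)) r)) ^ (1 / (3 : ℝ)))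
    -- the radii
    {r₁ r₂ : ℝ} (hr₂ : 0 < r₂) (hr : r₂ < r₁) (hr₁ : r₁ ≤ ρ) :
    ∫⁻ p in Ioo (-r₂ ^ 2) 0 ×ˢ ball (0 : EuclideanSpace ℝ (Fin 3)) r₂,
        ENNReal.ofReal (H (F p.1 p.2)) ^ (5 / 3 : ℝ) ∂((volume : Measure ℝ).prod volume) ≤
      ENNReal.ofReal ((5 / 2) *
        (SNormLESNormFDerivOfEqConst ℝ (volume : Measure (EuclideanSpace ℝ (Fin 3))) 2 : ℝ) ^ 2 *
        (((4 * κ * (Cφ / (r₁ - r₂)) ^ 2 + CT / (r₁ ^ 2 - r₂ ^ 2)) *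
              (volume.real (closedBall (0 : EuclideanSpace ℝ (Fin 3)) r₁)) ^ (1 / (3 : ℝ)) +
            4 * κ * (Cφ / (r₁ - r₂)) ^ 2 * CJ * (CB : ℝ) ^ 2 *
              (volume.real (ball (0 : EuclideanSpace ℝ (Fin 3)) r₁)) ^ (1 / (3 : ℝ))) *
          (r₁ ^ 2) ^ (1 / (3 : ℝ))) ^ (5 / 3 : ℝ)) *
      (∫⁻ p in Ioc (-r₁ ^ 2) 0 ×ˢ closedBall (0 : EuclideanSpace ℝ (Fin 3)) r₁,
        ENNReal.ofReal (H (F p.1 p.2)) ^ (3 / 2 : ℝ) ∂((volume : Measure ℝ).prod volume)) ^ (10 / 9 : ℝ) := by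
  -- ### elementary facts on the radii
  have hr₁0 : 0 < r₁ := hr₂.trans hr
  have hT : r₂ ^ 2 < r₁ ^ 2 := by nlinarith
  have hT₂ : 0 < r₂ ^ 2 := by positivity
  have hI : Ioc (-r₁ ^ 2) (0 : ℝ) ⊆ Ioc (-ρ ^ 2) 0 := Ioc_subset_Ioc (by nlinarith) le_rfl
  set K : Set (EuclideanSpace ℝ (Fin 3)) := closedBall 0 r₁ with hK
  have hKc : IsCompact K := isCompact_closedBall _ _
  have hKρ : K ⊆ closedBall 0 ρ := closedBall_subset_closedBall hr₁
  -- ### the cut-offs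
  set φ : EuclideanSpace ℝ (Fin 3) → ℝ := radialCutoff r₂ r₁ with hφdef
  have hφ : ContDiff ℝ 2 φ := radialCutoff_contDiff r₂ r₁
  have hφ1C : ContDiff ℝ 1 φ := radialCutoff_contDiff r₂ r₁
  have hφc : HasCompactSupport φ := hasCompactSupport_radialCutoff hr₂.le hr
  have hφa : IsAxisymmetricScalar φ := radialCutoff_axisymmetric r₂ r₁
  have hφr : ∀ x, φ x * fderiv ℝ φ x (eR x) ≤ 0 := radialCutoff_mul_fderiv_eR_nonpos hr hr₂.le
  have hφ1 : ∀ x ∈ ball (0 : EuclideanSpace ℝ (Fin 3)) r₂, φ x = 1 := fun x hx =>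
    radialCutoff_eq_one hr₂.le hr (le_of_lt (mem_ball_zero_iff.1 hx))
  have hφK : tsupport φ ⊆ K := tsupport_radialCutoff_subset_closedBall hr₂.le hr
  have hφ01 : ∀ x, 0 ≤ φ x ∧ φ x ≤ 1 := fun x => ⟨radialCutoff_nonneg _ _ _, radialCutoff_le_one _ _ _⟩
  set D : ℝ := Cφ / (r₁ - r₂) with hD
  have hφD : ∀ x, ‖gradient φ x‖ ≤ D := fun x => hCφ r₂ r₁ hr₂.le hr x
  have hD0 : 0 ≤ D := (norm_nonneg _).trans (hφD 0)
  obtain ⟨hηC, hη1, hη2, hη01, hηD⟩ := timeCutoff_props (T₁ := r₁ ^ 2) (T₂ := r₂ ^ 2) hT hCT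
  set η : ℝ → ℝ := fun s => Real.smoothTransition ((s + r₁ ^ 2) / (r₁ ^ 2 - r₂ ^ 2)) with hηdef
  set D' : ℝ := CT / (r₁ ^ 2 - r₂ ^ 2) with hD'
  have hD'0 : 0 ≤ D' := (abs_nonneg _).trans (hηD 0)
  have hη0 : η (-r₁ ^ 2) = 0 := by simp only [hηdef]; rw [show -r₁ ^ 2 + r₁ ^ 2 = -(r₁ ^ 2) + r₁ ^ 2 by ring]; exact hη1
  -- support facts
  have hφ0K : ∀ x, x ∉ K → φ x = 0 := fun x hx => image_eq_zero_of_notMem_tsupport fun h => hx (hφK h)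
  have hφ2 : ContDiff ℝ 1 fun y => φ y ^ 2 := hφ1C.pow 2
  have hgradφ2c : Continuous (gradient fun y => φ y ^ 2) := continuous_gradient_of_contDiff hφ2
  have htsupp2 : tsupport (fun y => φ y ^ 2) ⊆ K := by
    refine (closure_mono ?_).trans ((isClosed_closedBall).closure_subset_iff.2 (subset_tsupport _ |>.trans hφK))
    intro x hx
    simp only [mem_support, ne_eq, pow_eq_zero_iff, OfNat.ofNat_ne_zero, not_false_eq_true] at hx
    exact hx
  have hgradφ2K : ∀ x, x ∉ K → gradient (fun y => φ y ^ 2) x = 0 := fun x hx =>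
    gradient_eq_zero_of_notMem_tsupport fun h => hx (htsupp2 h)
  have hfderivφ2K : ∀ x, x ∉ K → fderiv ℝ (fun y => φ y ^ 2) x = 0 := fun x hx =>
    fderiv_of_notMem_tsupport ℝ fun h => hx (htsupp2 h)
  obtain ⟨D₂, hD₂⟩ : ∃ D₂, ∀ x, ‖gradient (fun y => φ y ^ 2) x‖ ≤ D₂ :=
    hgradφ2c.bounded_above_of_compact_support (HasCompactSupport.intro hKc fun x hx => hgradφ2K x hx)
  -- ### bounds for `H(F)`, `H'(F)` on `[−r₁², 0] × K`
  have hHFc : Continuous fun p : ℝ × EuclideanSpace ℝ (Fin 3) => H (F p.1 p.2) := hH.continuous.comp hFc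
  have hH'c : Continuous (deriv H) := hH.continuous_deriv (by norm_num)
  have hH''c : Continuous (deriv (deriv H)) := by
    have h2 : ContDiff ℝ (1 + 1) H := by rw [one_add_one_eq_two]; exact hH
    exact h2.deriv'.continuous_deriv le_rfl
  have hH'Fc : Continuous fun p : ℝ × EuclideanSpace ℝ (Fin 3) => deriv H (F p.1 p.2) := hH'c.comp hFc
  have hcpt : IsCompact (Icc (-r₁ ^ 2) (0 : ℝ) ×ˢ K) := isCompact_Icc.prod hKc
  obtain ⟨CH, hCH⟩ : ∃ C, ∀ p ∈ Icc (-r₁ ^ 2) (0 : ℝ) ×ˢ K, ‖H (F p.1 p.2)‖ ≤ C :=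
    hcpt.exists_bound_of_continuousOn hHFc.continuousOn
  obtain ⟨CH', hCH'⟩ : ∃ C, ∀ p ∈ Icc (-r₁ ^ 2) (0 : ℝ) ×ˢ K, ‖deriv H (F p.1 p.2)‖ ≤ C :=
    hcpt.exists_bound_of_continuousOn hH'Fc.continuousOn
  -- a global bound for `H(F)` on `ℝ × K` is not available; we only need it for `s ∈ (−r₁², 0]`.
  -- ### restrictions of the equation data to `[−r₁², 0]`
  have hBst' : ∀ᵐ s ∂(volume.restrict (Ioc (-r₁ ^ 2) 0)),
      Differentiable ℝ (Bst s) ∧ curl (Bst s) =ᵐ[volume] b s := by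
    filter_upwards [ae_restrict_of_ae_restrict_of_subset hI hBst] with s hs
    exact ⟨hs.1, hs.2.1⟩
  have heq' : ∀ᵐ x ∂(volume : Measure (EuclideanSpace ℝ (Fin 3))),
      IntervalIntegrable (fun s => N s x) volume (-r₁ ^ 2) 0 ∧
        ∀ s ∈ Icc (-r₁ ^ 2) 0, F s x = F (-r₁ ^ 2) x + ∫ τ in (-r₁ ^ 2)..s, N τ x := by
    filter_upwards [heq] with x hx
    exact integrated_eq_rebase (Fx := fun s => F s x) (Nx := fun s => N s x) (by nlinarith) (by nlinarith)
      hx.1 hx.2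
  -- ### the space–time integrability of the tested equation
  have hint : Integrable (fun p : ℝ × EuclideanSpace ℝ (Fin 3) =>
      (deriv H (F p.1 p.2) * N p.1 p.2 * η p.1 + H (F p.1 p.2) * deriv η p.1) * φ p.2 ^ 2)
      ((volume.restrict (Ioc (-r₁ ^ 2) 0)).prod volume) := by
    -- the measure and its null sets
    set μ₁ : Measure (ℝ × EuclideanSpace ℝ (Fin 3)) := (volume.restrict (Ioc (-r₁ ^ 2) 0)).prod volume
      with hμ₁
    have hNm₁ : AEStronglyMeasurable (fun p : ℝ × EuclideanSpace ℝ (Fin 3) => N p.1 p.2) μ₁ :=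
      hNm.mono_measure (Measure.prod_mono (Measure.restrict_mono hI le_rfl) le_rfl)
    have hηc : Continuous η := hηC.continuous
    have hη'c : Continuous (deriv η) := hηC.continuous_deriv le_rfl
    have hfm : AEStronglyMeasurable (fun p : ℝ × EuclideanSpace ℝ (Fin 3) =>
        (deriv H (F p.1 p.2) * N p.1 p.2 * η p.1 + H (F p.1 p.2) * deriv η p.1) * φ p.2 ^ 2) μ₁ := by
      refine AEStronglyMeasurable.mul (AEStronglyMeasurable.add ?_ ?_) ?_
      · exact (hH'Fc.aestronglyMeasurable.mul hNm₁).mul (hηc.comp continuous_fst).aestronglyMeasurable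
      · exact (hHFc.mul (hη'c.comp continuous_fst)).aestronglyMeasurable
      · exact ((hφ.continuous.comp continuous_snd).pow 2).aestronglyMeasurable
    -- the dominating function `1_K(x) (C_H' |N| + C_H D')`
    set g : ℝ × EuclideanSpace ℝ (Fin 3) → ℝ := fun p =>
      (univ ×ˢ K : Set (ℝ × EuclideanSpace ℝ (Fin 3))).indicator
        (fun p => CH' * ‖N p.1 p.2‖ + CH * D') p with hg
    have hgi : Integrable g μ₁ := by
      rw [hg, integrable_indicator_iff (MeasurableSet.univ.prod hKc.measurableSet)]
      have hres : μ₁.restrict (univ ×ˢ K) = (volume.restrict (Ioc (-r₁ ^ 2) 0)).prod (volume.restrict K) := by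
        rw [hμ₁, ← Measure.restrict_univ (μ := volume.restrict (Ioc (-r₁ ^ 2) (0:ℝ))),
          Measure.prod_restrict, Measure.restrict_univ]
      rw [IntegrableOn, hres]
      have hNi₁ : Integrable (fun p : ℝ × EuclideanSpace ℝ (Fin 3) => N p.1 p.2)
          ((volume.restrict (Ioc (-r₁ ^ 2) 0)).prod (volume.restrict K)) :=
        hNi.mono_measure (Measure.prod_mono (Measure.restrict_mono hI le_rfl) (Measure.restrict_mono hKρ le_rfl))
      haveI : IsFiniteMeasure ((volume.restrict (Ioc (-r₁ ^ 2) (0:ℝ))).prod (volume.restrict K)) := by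
        haveI : IsFiniteMeasure (volume.restrict (Ioc (-r₁ ^ 2) (0:ℝ))) := ⟨by
          rw [Measure.restrict_apply_univ]; exact measure_Ioc_lt_top⟩
        haveI : IsFiniteMeasure ((volume : Measure (EuclideanSpace ℝ (Fin 3))).restrict K) := ⟨by
          rw [Measure.restrict_apply_univ]; exact hKc.measure_lt_top⟩
        infer_instance
      exact (hNi₁.norm.const_mul CH').add (integrable_const _)
    refine hgi.mono' hfm ?_
    -- the pointwise bound, for a.e. `p` (those with `p.1 ∈ (−r₁², 0]`)
    have hmem : ∀ᵐ p ∂μ₁, p.1 ∈ Ioc (-r₁ ^ 2) (0 : ℝ) := by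
      rw [hμ₁, Measure.restrict_prod_eq_prod_univ]
      filter_upwards [ae_restrict_mem (measurableSet_Ioc.prod MeasurableSet.univ)] with p hp
      exact hp.1
    filter_upwards [hmem] with p hp
    by_cases hx : p.2 ∈ K
    · have hpI : p ∈ Icc (-r₁ ^ 2) (0 : ℝ) ×ˢ K := ⟨Ioc_subset_Icc_self hp, hx⟩
      simp only [hg]
      rw [indicator_of_mem (show p ∈ (univ ×ˢ K : Set _) from ⟨mem_univ _, hx⟩)]
      have h1 : ‖deriv H (F p.1 p.2)‖ ≤ CH' := hCH' p hpI
      have h2 : ‖H (F p.1 p.2)‖ ≤ CH := hCH p hpI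
      have h3 : |η p.1| ≤ 1 := by rw [abs_of_nonneg (hη01 p.1).1]; exact (hη01 p.1).2
      have h4 : |deriv η p.1| ≤ D' := hηD p.1
      have h5 : φ p.2 ^ 2 ≤ 1 := by have := hφ01 p.2; nlinarith
      have hCH0 : 0 ≤ CH := (norm_nonneg _).trans h2
      have hCH'0 : 0 ≤ CH' := (norm_nonneg _).trans h1
      rw [Real.norm_eq_abs, abs_mul, abs_of_nonneg (sq_nonneg (φ p.2))]
      calc |deriv H (F p.1 p.2) * N p.1 p.2 * η p.1 + H (F p.1 p.2) * deriv η p.1| * φ p.2 ^ 2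
          ≤ (|deriv H (F p.1 p.2)| * |N p.1 p.2| * |η p.1| + |H (F p.1 p.2)| * |deriv η p.1|) * 1 := by
            refine mul_le_mul ((abs_add_le _ _).trans (by rw [abs_mul, abs_mul, abs_mul])) h5 (sq_nonneg _)
              (by positivity)
        _ ≤ CH' * ‖N p.1 p.2‖ + CH * D' := by
            rw [mul_one, Real.norm_eq_abs]
            refine add_le_add ?_ ?_
            · calc |deriv H (F p.1 p.2)| * |N p.1 p.2| * |η p.1| ≤ CH' * |N p.1 p.2| * 1 := by
                    refine mul_le_mul (mul_le_mul_of_nonneg_right ((Real.norm_eq_abs _).symm.le.trans h1)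
                      (abs_nonneg _)) h3 (abs_nonneg _) (by positivity)
                _ = CH' * |N p.1 p.2| := mul_one _
            · exact mul_le_mul ((Real.norm_eq_abs _).symm.le.trans h2) h4 (abs_nonneg _) hCH0
    · rw [hφ0K p.2 hx]
      simp only [hg]
      rw [indicator_of_notMem (show p ∉ (univ ×ˢ K : Set _) from fun h => hx h.2)]
      simp
  -- ### the slice functionals and their integrability in time
  have hGc : Continuous fun s => ∫ x, deriv (deriv H) (F s x) * ‖gradient (F s) x‖ ^ 2 * φ x ^ 2 :=
    continuous_integral_of_continuous_of_support
      ((( hH''c.comp hFc).mul (hF1c.norm.pow 2)).mul ((hφ.continuous.comp continuous_snd).pow 2))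
      hKc (fun s x hx => by rw [hφ0K x hx]; ring)
  have hMc : Continuous fun s => ∫ x, H (F s x) * φ x ^ 2 :=
    continuous_integral_of_continuous_of_support (hHFc.mul ((hφ.continuous.comp continuous_snd).pow 2))
      hKc (fun s x hx => by rw [hφ0K x hx]; ring)
  have hT₁c : Continuous fun s => ∫ x, deriv H (F s x) * ⟪gradient (F s) x, gradient (fun y => φ y ^ 2) x⟫ :=
    continuous_integral_of_continuous_of_support
      (hH'Fc.mul (hF1c.inner (hgradφ2c.comp continuous_snd)))
      hKc (fun s x hx => by rw [hgradφ2K x hx, inner_zero_right, mul_zero])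
  -- `T₂`: bounded jointly measurable integrand supported in `K`
  have hT₂i : IntervalIntegrable (fun s => ∫ x, H (F s x) * ⟪b s x, gradient (fun y => φ y ^ 2) x⟫)
      volume (-r₁ ^ 2) 0 := by
    have hf : Integrable (fun p : ℝ × EuclideanSpace ℝ (Fin 3) =>
        H (F p.1 p.2) * ⟪b p.1 p.2, gradient (fun y => φ y ^ 2) p.2⟫)
        ((volume.restrict (Ioc (-r₁ ^ 2) 0)).prod volume) := by
      refine integrable_prod_of_le_mul_one_add_inv_cylRadius (K := K) hKc ?_ ?_ (C := CH * Mb * D₂) ?_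
      · have hbm₁ := hbm.mono_measure (Measure.prod_mono (Measure.restrict_mono hI le_rfl) le_rfl)
        exact hHFc.aestronglyMeasurable.mul (hbm₁.inner (hgradφ2c.comp continuous_snd).aestronglyMeasurable)
      · intro s x hx
        show H (F s x) * ⟪b s x, gradient (fun y => φ y ^ 2) x⟫ = 0
        rw [hgradφ2K x hx, inner_zero_right, mul_zero]
      · intro s hs x hx
        show |H (F s x) * ⟪b s x, gradient (fun y => φ y ^ 2) x⟫| ≤ CH * Mb * D₂ * (1 + (cylRadius x)⁻¹)
        have h1 : ‖H (F s x)‖ ≤ CH := hCH (s, x) ⟨Ioc_subset_Icc_self hs, hx⟩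
        have h2 : ‖b s x‖ ≤ Mb := hbB s x (hKρ hx)
        have h3 := hD₂ x
        have hr0 : 0 ≤ (cylRadius x)⁻¹ := inv_nonneg.2 (cylRadius_nonneg x)
        have hCH0 : 0 ≤ CH := (norm_nonneg _).trans h1
        have hMb0 : 0 ≤ Mb := (norm_nonneg _).trans h2
        calc |H (F s x) * ⟪b s x, gradient (fun y => φ y ^ 2) x⟫|
            = |H (F s x)| * |⟪b s x, gradient (fun y => φ y ^ 2) x⟫| := abs_mul _ _
          _ ≤ CH * (Mb * D₂) := by
              refine mul_le_mul ((Real.norm_eq_abs _).symm.le.trans h1)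
                ((abs_real_inner_le_norm _ _).trans (mul_le_mul h2 h3 (norm_nonneg _) hMb0))
                (abs_nonneg _) hCH0
          _ = CH * Mb * D₂ * 1 := by ring
          _ ≤ CH * Mb * D₂ * (1 + (cylRadius x)⁻¹) := by
              refine mul_le_mul_of_nonneg_left (by linarith) ?_
              exact mul_nonneg (mul_nonneg hCH0 hMb0) ((norm_nonneg _).trans h3)
    have h := hf.integral_prod_left
    exact (intervalIntegrable_iff_integrableOn_Ioc_of_le (by nlinarith : -r₁ ^ 2 ≤ (0:ℝ))).2 h
  -- `T₃`: the axis term, integrand bounded by `C (1 + 1/r)` on `K`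
  have hT₃i : IntervalIntegrable
      (fun s => ∫ x, 2 / cylRadius x * (H (F s x) * fderiv ℝ (fun y => φ y ^ 2) x (eR x)))
      volume (-r₁ ^ 2) 0 := by
    obtain ⟨D₃, hD₃⟩ : ∃ D₃, ∀ x, ‖fderiv ℝ (fun y => φ y ^ 2) x‖ ≤ D₃ :=
      (hφ2.continuous_fderiv one_ne_zero).bounded_above_of_compact_support
        (HasCompactSupport.intro hKc fun x hx => hfderivφ2K x hx)
    have hD₃0 : 0 ≤ D₃ := (norm_nonneg _).trans (hD₃ 0)
    have hf : Integrable (fun p : ℝ × EuclideanSpace ℝ (Fin 3) =>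
        2 / cylRadius p.2 * (H (F p.1 p.2) * fderiv ℝ (fun y => φ y ^ 2) p.2 (eR p.2)))
        ((volume.restrict (Ioc (-r₁ ^ 2) 0)).prod volume) := by
      refine integrable_prod_of_le_mul_one_add_inv_cylRadius (K := K) hKc ?_ ?_ (C := 2 * (CH * D₃)) ?_
      · -- measurability
        have h1 : Measurable fun p : ℝ × EuclideanSpace ℝ (Fin 3) => 2 / cylRadius p.2 :=
          measurable_const.div (continuous_cylRadius.measurable.comp measurable_snd)
        have h2 : Measurable fun p : ℝ × EuclideanSpace ℝ (Fin 3) =>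
            fderiv ℝ (fun y => φ y ^ 2) p.2 (eR p.2) := by
          have h : Measurable fun p : ℝ × EuclideanSpace ℝ (Fin 3) =>
              ⟪gradient (fun y => φ y ^ 2) p.2, eR p.2⟫ :=
            Measurable.inner (hgradφ2c.measurable.comp measurable_snd) (measurable_eR.comp measurable_snd)
          -- `⟪∇(φ²), e_r⟫ = D(φ²)[e_r]`
          have e : (fun p : ℝ × EuclideanSpace ℝ (Fin 3) => fderiv ℝ (fun y => φ y ^ 2) p.2 (eR p.2)) =
              fun p => ⟪gradient (fun y => φ y ^ 2) p.2, eR p.2⟫ :=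
            funext fun p => (inner_gradient_left (fun y => φ y ^ 2) p.2 (eR p.2)).symm
          rw [e]; exact h
        exact h1.aestronglyMeasurable.mul (hHFc.aestronglyMeasurable.mul h2.aestronglyMeasurable)
      · intro s x hx
        show 2 / cylRadius x * (H (F s x) * fderiv ℝ (fun y => φ y ^ 2) x (eR x)) = 0
        rw [hfderivφ2K x hx]; simp
      · intro s hs x hx
        show |2 / cylRadius x * (H (F s x) * fderiv ℝ (fun y => φ y ^ 2) x (eR x))| ≤
          2 * (CH * D₃) * (1 + (cylRadius x)⁻¹)
        have h1 : ‖H (F s x)‖ ≤ CH := hCH (s, x) ⟨Ioc_subset_Icc_self hs, hx⟩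
        have hCH0 : 0 ≤ CH := (norm_nonneg _).trans h1
        have h2 : ‖fderiv ℝ (fun y => φ y ^ 2) x (eR x)‖ ≤ D₃ := by
          calc ‖fderiv ℝ (fun y => φ y ^ 2) x (eR x)‖ ≤ ‖fderiv ℝ (fun y => φ y ^ 2) x‖ * ‖eR x‖ :=
                ContinuousLinearMap.le_opNorm _ _
            _ ≤ D₃ * 1 := mul_le_mul (hD₃ x) (norm_eR_le_one x) (norm_nonneg _) hD₃0
            _ = D₃ := mul_one _
        have hr0 : 0 ≤ (cylRadius x)⁻¹ := inv_nonneg.2 (cylRadius_nonneg x)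
        rw [abs_mul, abs_div, abs_two, abs_of_nonneg (cylRadius_nonneg x), abs_mul, div_eq_mul_inv]
        have h3 : |H (F s x)| * |fderiv ℝ (fun y => φ y ^ 2) x (eR x)| ≤ CH * D₃ :=
          mul_le_mul ((Real.norm_eq_abs _).symm.le.trans h1) ((Real.norm_eq_abs _).symm.le.trans h2)
            (abs_nonneg _) hCH0
        calc 2 * (cylRadius x)⁻¹ * (|H (F s x)| * |fderiv ℝ (fun y => φ y ^ 2) x (eR x)|)
            ≤ 2 * (cylRadius x)⁻¹ * (CH * D₃) := mul_le_mul_of_nonneg_left h3 (by positivity)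
          _ ≤ 2 * (CH * D₃) * (1 + (cylRadius x)⁻¹) := by nlinarith [mul_nonneg hCH0 hD₃0]
    have h := hf.integral_prod_left
    exact (intervalIntegrable_iff_integrableOn_Ioc_of_le (by nlinarith : -r₁ ^ 2 ≤ (0:ℝ))).2 h
  -- ### the John–Nirenberg bound of the stream oscillation, for a.e. `s`
  classical
  set c : ℝ → EuclideanSpace ℝ (Fin 3) := fun s =>
    if h : Differentiable ℝ (Bst s) ∧ eBMOSeminormVec (Bst s) ≤ CB then
      Classical.choose (hCJ (Bst s) h.1.continuous CB h.2 r₁ hr₁0) else 0 with hcdef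
  have hc : ∀ᵐ s ∂(volume.restrict (Ioc (-r₁ ^ 2) 0)),
      (∫ x in closedBall (0 : EuclideanSpace ℝ (Fin 3)) r₁, (‖Bst s x - c s‖ ^ 2) ^ (3 : ℝ)) ^ (1 / (3 : ℝ)) ≤
        CJ * (CB : ℝ) ^ 2 * (volume.real (ball (0 : EuclideanSpace ℝ (Fin 3)) r₁)) ^ (1 / (3 : ℝ)) := by
    filter_upwards [ae_restrict_of_ae_restrict_of_subset hI hBst] with s hs
    have hcond : Differentiable ℝ (Bst s) ∧ eBMOSeminormVec (Bst s) ≤ CB := ⟨hs.1, hs.2.2⟩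
    have hcs : c s = Classical.choose (hCJ (Bst s) hcond.1.continuous CB hcond.2 r₁ hr₁0) := by
      simp only [hcdef, dif_pos hcond]
    rw [hcs]
    exact Classical.choose_spec (hCJ (Bst s) hcond.1.continuous CB hcond.2 r₁ hr₁0)
  -- ### apply the analytic core
  have hmain := reverse_holder_step (r₁ := r₁) (r₂ := r₂) (T₁ := r₁ ^ 2) (T₂ := r₂ ^ 2) hT₂ hT
    hF2 hFa hF0 hb hBst' hN heq' hH hH00 hH0 hH2 hκ1 hκ hsH hsH2 hsH'
    hφ hφc hφa hφr hφ1 hφK hφ01 hφD (η := η) hηC hη0 hη2 hη01 hηD hint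
    (G := fun s => ∫ x, deriv (deriv H) (F s x) * ‖gradient (F s) x‖ ^ 2 * φ x ^ 2)
    (T₁f := fun s => ∫ x, deriv H (F s x) * ⟪gradient (F s) x, gradient (fun y => φ y ^ 2) x⟫)
    (T₂f := fun s => ∫ x, H (F s x) * ⟪b s x, gradient (fun y => φ y ^ 2) x⟫)
    (T₃f := fun s => ∫ x, 2 / cylRadius x * (H (F s x) * fderiv ℝ (fun y => φ y ^ 2) x (eR x)))
    (M := fun s => ∫ x, H (F s x) * φ x ^ 2)
    (fun s => rfl) (fun s => rfl) (fun s => rfl) (fun s => rfl) (fun s => rfl)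
    (hGc.intervalIntegrable _ _) (hT₁c.intervalIntegrable _ _) hT₂i hT₃i (hMc.intervalIntegrable _ _)
    hHFc hCJ0 hc
  exact hmain

end LeiZhang2011

end Literature.Analysis.FluidPDE
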